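import Summits.CriticalPhenomena.PercolationContinuityZ3.Theses.PercLowPointHalfSpace
import Summits.CriticalPhenomena.PercolationContinuityZ3.Theorems.PercLowPointHalfSpaceQuantitativeBGNFloorDefs
import Summits.CriticalPhenomena.PercolationContinuityZ3.Theorems.PercLowPointHalfSpaceQuantitativeBGNFloorArmLocality
import Summits.CriticalPhenomena.PercolationContinuityZ3.Theorems.PercLowPointHalfSpaceQuantitativeBGNFloorDepthMono
import Summits.CriticalPhenomena.PercolationContinuityZ3.Theorems.PercLowPointHalfSpaceQuantitativeBGNFloorNoFloor
import Summits.CriticalPhenomena.PercolationContinuityZ3.Theorems.PercLowPointHalfSpaceQuantitativeBGNFloorRussoCalc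
import Summits.CriticalPhenomena.PercolationContinuityZ3.Theorems.PercLowPointHalfSpaceQuantitativeBGNFloorDeriv
import Literature.Probability.Percolation.ProdBernoulliRusso
import Literature.Probability.Percolation.BondPercolationSymmetry
import Mathlib.MeasureTheory.Integral.IntervalIntegral.FundThmCalculus
import Mathlib.Analysis.SpecialFunctions.Pow.Real
import HarnessLib.Audit

/-!
# Line `microscopic-floor-doubling-gain` for the crux `QuantitativeBGN` (stmt-CriticalPhenomena-0913) — lead c2 skeleton

Lead: prover-line-stmt-CriticalPhenomena-0913-c2-0 (2026-08-16), rebuilt from the planner's skeleton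
`Cruxes/QuantitativeBGN/Lines/microscopic-floor-doubling-gain.lean` (crux-plan r1; triage r1: 3 × pass) with two
changes: (a) the line's OBJECTS live in the reviewed definitions file
`Theorems/PercLowPointHalfSpaceQuantitativeBGNFloorDefs.lean` (namespace `…Theorems.FloorDoubling`: `armFrom`,
`gammaR`, `armProbFloor` over the Literature's floor-diluted half-space measure `floorDilutedPercolation 3 p_c s`
— floor edges at density `s·p_c`, `s ∈ [0,1]` — `floorEdgesIn`, `pivotalFloorSum`, `floorLogGain`) so that
every stub below is a closed statement over importable vocabulary and lands in its own Theorems file; (b) the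
planner's `stub_floorRusso` is cut into a percolation half `stub_floorDeriv` (readback at `s = 1`, continuity,
and `f_j' = p_c g_j` on `(0,1)` from the tree's multi-parameter Russo formula `hasDerivAt_prodBernoulli_real`)
and a calculus half `stub_russoCalc` (FTC for `log f`), glued here (`floorRusso_of`).

THE LINE. `γ_r(h) := P_{p_c}(armFrom r h)` = probability that the `H`-cluster of `h·e₀` reaches sup-distance
`≥ r` (`γ_r(0)` is literally the crux probability, `FloorDoubling.gammaR_zero_eq`, LANDED with the Defs).
STUB 1 `γ_r(h) ≤ γ_r(h+1)` (shift). The lever is the uniform microscopic doubling gain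
`(G)`: `∃ κ δ h₀ ∀ r ∀ h ∈ [h₀, r^δ/2]: γ_r(2h) ≥ (1+κ)γ_r(h)`; its dyadic iteration gives the crux with
`a = δ log₂(1+κ)` (`quantitativeBGN_of_floorGain`, PROVED below). `(G)` is cut along its exact floor-pivotality
form: `f_j(s) := P^{ℍ}_{p_c,s}(armFrom r j)`, `g_j(s) := Σ_e P^{ℍ}_{p_c,s}(e pivotal)`, `I_j := ∫₀¹ p_c g_j/f_j`;
STUB 2 `γ_r(j) ≤ f_{j+1}(0)`; STUBS 3a+3b ⟹ `f_j(0) e^{I_j} ≤ γ_r(j)`; STUB 4 (LOAD-BEARING, OPEN):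
`Σ_{j∈(h,2h]} I_j ≥ κ'` on the window; telescoping gives `(G)` with `1+κ = e^{κ'}` (`floorGain_of_russo`, PROVED).

Disproof used (`Cruxes/QuantitativeBGN/Disproof.lean` v5; Negative lane `Theorems/QuantitativeBGN/Negative/*`, imported
via the Defs): `p = p_c` enters only at STUB 4 (false above `p_c`: it implies the crux through the sorry-free
composition; `quantitativeBGNAt_false_of_criticalProb_lt`); STUBS 1–3b are `p`-blind plumbing; output exponent
`δ log₂(1+κ)` inside the window `(0, 2]` of `armH_lower_bound`; guard `1 ≤ r` kept; `gammaR_pos` certifies every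
ratio compares positive numbers; no exponential rate claimed (`not_expDecay_at_criticalProb`).
-/

noncomputable section

namespace Summit.CriticalPhenomena.PercolationContinuityZ3.Cruxes.QuantitativeBGN.MicroscopicFloorDoublingGain

open MeasureTheory Literature.Probability.Percolation Literature.Probability.LatticeModels
open Summit.CriticalPhenomena.PercolationContinuityZ3.Theorems.FloorDoubling
open scoped Classical

/-! ## Named statements of the line (local abbreviations; the registered stubs below spell them out) -/

/-- **(G)**, the uniform microscopic floor-doubling gain. -/
def FloorGain : Prop :=
  ∃ κ δ : ℝ, ∃ h₀ : ℕ, 0 < κ ∧ 0 < δ ∧ 1 ≤ h₀ ∧ ∀ r h : ℕ, h₀ ≤ h →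
    ((2 * h : ℕ) : ℝ) ≤ (r : ℝ) ^ δ → (1 + κ) * gammaR r h ≤ gammaR r (2 * h)

/-- STUB 1 statement: free monotonicity in the depth. -/
def DepthMono : Prop := ∀ r h : ℕ, gammaR r h ≤ gammaR r (h + 1)

/-- STUB 2 statement: the `s = 0` end of the interpolation dominates the previous depth. -/
def NoFloor : Prop := ∀ r j : ℕ, gammaR r j ≤ armProbFloor r (j + 1) 0

/-- STUB 3 statement (glued from 3a + 3b): integrated one-sided Russo formula in the floor parameter. -/
def FloorRusso : Prop :=
  ∀ r j : ℕ, armProbFloor r j 0 * Real.exp (floorLogGain r j) ≤ gammaR r j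

/-- STUB 3a statement: readback at `s = 1`, continuity, and the derivative `f_j' = p_c · g_j` on `(0,1)`. -/
def FloorDeriv : Prop :=
  ∀ r j : ℕ, armProbFloor r j 1 = gammaR r j ∧
    Continuous (fun t : ℝ => armProbFloor r j (Set.projIcc (0 : ℝ) 1 zero_le_one t)) ∧
    Continuous (fun t : ℝ => pivotalFloorSum r j (Set.projIcc (0 : ℝ) 1 zero_le_one t)) ∧
    ∀ b : ℝ, b ∈ Set.Ioo (0 : ℝ) 1 →
      HasDerivAt (fun t : ℝ => armProbFloor r j (Set.projIcc (0 : ℝ) 1 zero_le_one t))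
        ((criticalProbI 3 : ℝ) * pivotalFloorSum r j (Set.projIcc (0 : ℝ) 1 zero_le_one b)) b

/-- STUB 3b statement: the calculus lemma `f(0) · exp(∫₀¹ f'/f) ≤ f(1)` for a continuous `f ≥ 0` with a
continuous derivative `g ≥ 0` on `(0,1)`. -/
def RussoCalc : Prop :=
  ∀ f g : ℝ → ℝ, Continuous f → Continuous g → (∀ t, 0 ≤ f t) → (∀ t, 0 ≤ g t) →
    (∀ t ∈ Set.Ioo (0 : ℝ) 1, HasDerivAt f (g t) t) →
    f 0 * Real.exp (∫ t in (0 : ℝ)..1, g t / f t) ≤ f 1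

/-- STUB 4 statement (load-bearing): dyadic lower bound on the integrated pivotal-floor density. -/
def PivotalFloorDensity : Prop :=
  ∃ κ' δ : ℝ, ∃ h₀ : ℕ, 0 < κ' ∧ 0 < δ ∧ 1 ≤ h₀ ∧ ∀ r h : ℕ, h₀ ≤ h →
    ((2 * h : ℕ) : ℝ) ≤ (r : ℝ) ^ δ → κ' ≤ ∑ j ∈ Finset.Ioc h (2 * h), floorLogGain r j

/-! ## Registered stubs (signatures verbatim, one line each) -/

/-- **STUB 1 `stub_depthMono`** (S/M, LANDED p124045 — `Theorems.stub_depthMono`): `γ_r(h) ≤ γ_r(h+1)`. The vertical shift `x ↦ x + e₀`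
preserves `P_{p_c}` (`bondPercolation_real_preimage_relabel_iso` with `zdShiftIso (Pi.single 0 1)`) and maps
`armFrom r h` INTO `armFrom r (h+1)` (the image of an `H`-path is a `{x₀ ≥ 1}`-path `⊆ H`; distances are
measured from the start, so the witness `y + e₀` works). -/
theorem stub_depthMono :
    ∀ r h : ℕ, gammaR r h ≤ gammaR r (h + 1) :=
  Summit.CriticalPhenomena.PercolationContinuityZ3.Theorems.stub_depthMono

/-- **STUB 2 `stub_noFloor`** (M, LANDED p124349 — `Theorems.stub_noFloor`): `γ_r(j) ≤ f_{j+1}(0)`. Under `floorDilutedPercolation 3 p_c 0`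
the floor edges are a.s. closed and the other half-space lattice edges are i.i.d. at `p_c`. The event
`E₁ :=` "arm from `(j+1)·e₀` of sup-extent `≥ r` inside `{x₀ ≥ 1}`" (the shift of `armFrom r j` by `e₀`) is
determined by the pairs of points of `{x₀ ≥ 1}`, where the weights `floorDilutedParam 3 p_c 0` and the indicator
weights of `bondPercolation (zdGraph 3) p_c` agree, so `P^{ℍ}_{p_c,0}(E₁) = P_{p_c}(E₁)`
(`prodBernoulli_apply_eq_of_determinedBy`, `prodBernoulli_indicator_holds`); `P_{p_c}(E₁) = γ_r(j)` by the shift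
(as in STUB 1, with equality), and `E₁ ⊆ armFrom r (j+1)`. -/
theorem stub_noFloor :
    ∀ r j : ℕ, gammaR r j ≤ armProbFloor r (j + 1) 0 :=
  Summit.CriticalPhenomena.PercolationContinuityZ3.Theorems.stub_noFloor

/-- **STUB 3a `stub_floorDeriv`** (M/L, LANDED p124635 — `Theorems.stub_floorDeriv`): readback `f_j(1) = γ_r(j)`
(`floorDilutedPercolation_one_apply_eq` + `armFrom` determined by the half-space pairs + measurable), continuity
of `t ↦ f_j(projIcc t)` and `t ↦ g_j(projIcc t)` (cylinder polynomials: `armFrom r j` and each `{e pivotal}` are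
determined by the finite set `(box 3 (r+j)).sym2`, `RussoPath.prodBernoulli_real_eq_sum_powerset`, weights
continuous in `t`), and `HasDerivAt (t ↦ f_j(projIcc t)) (p_c · g_j(projIcc b)) b` for `b ∈ (0,1)`
(`hasDerivAt_prodBernoulli_real` along `b ↦ floorDilutedParam 3 p_c (projIcc b)`: derivative `p_c` on floor
edges, `0` elsewhere; pivotal terms outside `floorEdgesIn (r+j+1)` vanish, `EnhProp42.isPivotal_iff_of_determinedBy`). -/
theorem stub_floorDeriv :
    ∀ r j : ℕ, armProbFloor r j 1 = gammaR r j ∧ Continuous (fun t : ℝ => armProbFloor r j (Set.projIcc (0 : ℝ) 1 zero_le_one t)) ∧ Continuous (fun t : ℝ => pivotalFloorSum r j (Set.projIcc (0 : ℝ) 1 zero_le_one t)) ∧ ∀ b : ℝ, b ∈ Set.Ioo (0 : ℝ) 1 → HasDerivAt (fun t : ℝ => armProbFloor r j (Set.projIcc (0 : ℝ) 1 zero_le_one t)) ((criticalProbI 3 : ℝ) * pivotalFloorSum r j (Set.projIcc (0 : ℝ) 1 zero_le_one b)) b :=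
  Summit.CriticalPhenomena.PercolationContinuityZ3.Theorems.stub_floorDeriv

/-- **STUB 3b `stub_russoCalc`** (M, LANDED p124410 — `Theorems.stub_russoCalc`): for continuous `f, g ≥ 0` with
`HasDerivAt f (g t) t` on `(0,1)`: `f 0 · exp(∫₀¹ g/f) ≤ f 1`. If `f 0 = 0` trivial; else `f` is monotone on
`[0,1]` (`monotoneOn_of_deriv_nonneg`), so `f ≥ f 0 > 0` there, `log ∘ f` has derivative `g/f` on `(0,1)`
and is continuous on `[0,1]`, `g/f` is continuous on `[0,1]` hence interval-integrable, and the FTC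
(`intervalIntegral.integral_eq_sub_of_hasDerivAt_of_le`) gives `∫₀¹ g/f = log f 1 − log f 0` (equality). -/
theorem stub_russoCalc :
    ∀ f g : ℝ → ℝ, Continuous f → Continuous g → (∀ t, 0 ≤ f t) → (∀ t, 0 ≤ g t) → (∀ t ∈ Set.Ioo (0 : ℝ) 1, HasDerivAt f (g t) t) → f 0 * Real.exp (∫ t in (0 : ℝ)..1, g t / f t) ≤ f 1 :=
  Summit.CriticalPhenomena.PercolationContinuityZ3.Theorems.stub_russoCalc

/-- **STUB 4 `stub_pivotalFloorDensity`** (L/XL, OPEN — THE LOAD-BEARING STUB; the lead's):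
`∃ κ' δ h₀, ∀ r, ∀ h ∈ [h₀, r^δ/2] : Σ_{j ∈ (h,2h]} I_j ≥ κ'`, `I_j = ∫₀¹ p_c g_j/f_j = log(γ_r(j)/f_j(0))`.
Heuristic value `I_j ≈ (x_s − x_b)/j ≈ 0.50/j` in the crossover window `1 ≪ j ≪ r` (surface vs bulk one-arm
exponents `x_s ≈ 0.975`, `x_b ≈ 0.477`), so `κ' ≈ 0.35`; MC (triage-2, kit j009999): `γ_r(2h)/γ_r(h) = 1.22–1.29`
at `r ≤ 32`, rising with `r`. By exactness of Russo this is EQUIVALENT to `(G)` on the window; it is a uniform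
single-arm sensitivity statement (quasi-multiplicativity / RSW class) with no 3D member known; false above `p_c`. -/
theorem stub_pivotalFloorDensity :
    ∃ κ' δ : ℝ, ∃ h₀ : ℕ, 0 < κ' ∧ 0 < δ ∧ 1 ≤ h₀ ∧ ∀ r h : ℕ, h₀ ≤ h → ((2 * h : ℕ) : ℝ) ≤ (r : ℝ) ^ δ → κ' ≤ ∑ j ∈ Finset.Ioc h (2 * h), floorLogGain r j := by
  sorry

/-! ### Consistency: each named statement IS its registered stub (definitionally) -/

theorem depthMono_holds : DepthMono := stub_depthMono
theorem noFloor_holds : NoFloor := stub_noFloor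
theorem floorDeriv_holds : FloorDeriv := stub_floorDeriv
theorem russoCalc_holds : RussoCalc := stub_russoCalc
theorem pivotalFloorDensity_holds : PivotalFloorDensity := stub_pivotalFloorDensity

namespace Registered

/-- Alias of `DepthMono` keyed by the registered stub name. -/
abbrev stub_depthMono : Prop := DepthMono
/-- Alias of `NoFloor` keyed by the registered stub name. -/
abbrev stub_noFloor : Prop := NoFloor
/-- Alias of `FloorDeriv` keyed by the registered stub name. -/
abbrev stub_floorDeriv : Prop := FloorDeriv
/-- Alias of `RussoCalc` keyed by the registered stub name. -/
abbrev stub_russoCalc : Prop := RussoCalc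
/-- Alias of `PivotalFloorDensity` keyed by the registered stub name. -/
abbrev stub_pivotalFloorDensity : Prop := PivotalFloorDensity

end Registered

/-! ## Proved plumbing -/

/-- NO JUNK (Disproof honoured): under STUB 1 every `γ_r(h)`, `r ≥ 1`, is bounded below by the landed
`armH_lower_bound` `≥ 1/(588 r²) > 0`, so all ratios `γ_r(2h)/γ_r(h)` of the line compare positive numbers. -/
theorem gammaR_pos (hmono : DepthMono) {r : ℕ} (hr : 1 ≤ r) (h : ℕ) : 0 < gammaR r h := by
  have hmon : Monotone (gammaR r) := monotone_nat_of_le_succ fun k => hmono r k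
  refine lt_of_lt_of_le ?_ (hmon (Nat.zero_le h))
  obtain ⟨n, rfl⟩ : ∃ n, r = n + 1 := ⟨r - 1, by omega⟩
  have hlow := Theorems.QuantitativeBGN.Negative.armH_lower_bound n
  rw [gammaR_zero_eq_armH]
  exact lt_of_lt_of_le (by positivity) hlow

/-! ## Composition, part 0: STUBS 3a + 3b ⟹ the integrated Russo inequality -/

/-- `f_j(0) · exp(I_j) ≤ γ_r(j)`: the calculus lemma applied to `f = f_j ∘ projIcc`, `g = p_c · g_j ∘ projIcc`. -/
theorem floorRusso_of (hd : FloorDeriv) (hc : RussoCalc) : FloorRusso := by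
  intro r j
  obtain ⟨hone, hcontf, hcontg, hderiv⟩ := hd r j
  set f : ℝ → ℝ := fun t => armProbFloor r j (Set.projIcc (0 : ℝ) 1 zero_le_one t) with hf
  set g : ℝ → ℝ := fun t => (criticalProbI 3 : ℝ) * pivotalFloorSum r j (Set.projIcc (0 : ℝ) 1 zero_le_one t)
    with hg
  have hpc0 : (0 : ℝ) ≤ (criticalProbI 3 : ℝ) := (criticalProbI 3).2.1
  have key := hc f g hcontf (continuous_const.mul hcontg) (fun t => armProbFloor_nonneg _ _ _)
    (fun t => mul_nonneg hpc0 (pivotalFloorSum_nonneg _ _ _)) hderiv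
  have h0 : f 0 = armProbFloor r j 0 := by
    simp only [hf, Set.projIcc_left]; rfl
  have h1 : f 1 = gammaR r j := by
    simp only [hf, Set.projIcc_right]; exact hone
  have hI : (∫ t in (0 : ℝ)..1, g t / f t) = floorLogGain r j := by
    simp only [hf, hg, floorLogGain]
  rw [h0, h1, hI] at key
  exact key

/-! ## Composition, part 1: STUBS 2–4 ⟹ (G) -/

/-- Telescoping: `γ_r(j) e^{I_{j+1}} ≤ f_{j+1}(0) e^{I_{j+1}} ≤ γ_r(j+1)`, multiplied over a dyadic block, and
STUB 4 bounds the exponent sum below. -/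
theorem floorGain_of_russo (hnf : NoFloor) (hru : FloorRusso) (hpd : PivotalFloorDensity) :
    FloorGain := by
  obtain ⟨κ', δ, h₀, hκ', hδ, hh₀, hden⟩ := hpd
  refine ⟨Real.exp κ' - 1, δ, h₀, ?_, hδ, hh₀, fun r h hh hwin => ?_⟩
  · have := Real.add_one_lt_exp (ne_of_gt hκ')
    linarith
  have step : ∀ j : ℕ, gammaR r j * Real.exp (floorLogGain r (j + 1)) ≤ gammaR r (j + 1) :=
    fun j => le_trans (mul_le_mul_of_nonneg_right (hnf r j) (Real.exp_nonneg _)) (hru r (j + 1))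
  have tele : ∀ n : ℕ, gammaR r h * Real.exp (∑ j ∈ Finset.Ioc h (h + n), floorLogGain r j) ≤
      gammaR r (h + n) := by
    intro n
    induction n with
    | zero => simp
    | succ n ih =>
      rw [← add_assoc, Finset.sum_Ioc_succ_top (by omega : h ≤ h + n), Real.exp_add, ← mul_assoc]
      exact le_trans (mul_le_mul_of_nonneg_right ih (Real.exp_nonneg _)) (step (h + n))
  have key := tele h
  rw [← two_mul] at key
  have hsum : κ' ≤ ∑ j ∈ Finset.Ioc h (2 * h), floorLogGain r j := hden r h hh hwin
  calc (1 + (Real.exp κ' - 1)) * gammaR r h = gammaR r h * Real.exp κ' := by ring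
    _ ≤ gammaR r h * Real.exp (∑ j ∈ Finset.Ioc h (2 * h), floorLogGain r j) :=
        mul_le_mul_of_nonneg_left (Real.exp_le_exp.2 hsum) (gammaR_nonneg r h)
    _ ≤ gammaR r (2 * h) := key

/-! ## Composition, part 2: STUB 1 + (G) ⟹ the crux (the iteration) -/

/-- Iterated gain along the depths `h₀ · 2^j` inside the window. -/
theorem iter_gain {κ δ : ℝ} {h₀ : ℕ} (hκ : 0 < κ)
    (hG : ∀ r h : ℕ, h₀ ≤ h → ((2 * h : ℕ) : ℝ) ≤ (r : ℝ) ^ δ →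
      (1 + κ) * gammaR r h ≤ gammaR r (2 * h))
    (r : ℕ) : ∀ j : ℕ, ((h₀ * 2 ^ j : ℕ) : ℝ) ≤ (r : ℝ) ^ δ →
      (1 + κ) ^ j * gammaR r h₀ ≤ gammaR r (h₀ * 2 ^ j) := by
  intro j
  induction j with
  | zero => intro _; simp
  | succ j ih =>
    intro hj
    have hmono_pow : h₀ * 2 ^ j ≤ h₀ * 2 ^ (j + 1) :=
      Nat.mul_le_mul_left h₀ (Nat.pow_le_pow_right (by norm_num) (Nat.le_succ j))
    have hle : ((h₀ * 2 ^ j : ℕ) : ℝ) ≤ (r : ℝ) ^ δ := le_trans (by exact_mod_cast hmono_pow) hj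
    have h1 := ih hle
    have h3 : 2 * (h₀ * 2 ^ j) = h₀ * 2 ^ (j + 1) := by ring
    have h2 : (1 + κ) * gammaR r (h₀ * 2 ^ j) ≤ gammaR r (h₀ * 2 ^ (j + 1)) := by
      rw [← h3]
      refine hG r (h₀ * 2 ^ j) (Nat.le_mul_of_pos_right _ (by positivity)) ?_
      rw [h3]; exact hj
    calc (1 + κ) ^ (j + 1) * gammaR r h₀ = (1 + κ) * ((1 + κ) ^ j * gammaR r h₀) := by ring
      _ ≤ (1 + κ) * gammaR r (h₀ * 2 ^ j) := mul_le_mul_of_nonneg_left h1 (by linarith)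
      _ ≤ gammaR r (h₀ * 2 ^ (j + 1)) := h2

/-- **(G) ⟹ QuantitativeBGN** with `a = δ · log₂(1+κ)` and `C = (1+κ) · h₀^{log₂(1+κ)}`:
`γ_r(0) ≤ γ_r(h₀) ≤ (1+κ)^{-J}` with `J = ⌊log₂(r^δ/h₀)⌋`, and `(1+κ)^{log₂ y} = y^{log₂(1+κ)}`.
The conclusion is written as the disprover's readback `QuantitativeBGNAt (criticalProbI 3)` (= the crux by
`quantitativeBGN_iff`, `Iff.rfl`, landed in `Negative/ArmLowerBound.lean`) so that `QuantitativeBGN_of` below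
is the ONLY theorem of the file whose conclusion is the crux decl by name. -/
theorem quantitativeBGN_of_floorGain (hmono : DepthMono) (hG : FloorGain) :
    Theorems.QuantitativeBGN.Negative.QuantitativeBGNAt (criticalProbI 3) := by
  obtain ⟨κ, δ, h₀, hκ, hδ, hh₀, hG⟩ := hG
  set L : ℝ := Real.logb 2 (1 + κ) with hL
  have hκ1 : (1 : ℝ) < 1 + κ := by linarith
  have hLpos : 0 < L := Real.logb_pos (by norm_num) hκ1
  set a : ℝ := δ * L with ha
  have hapos : 0 < a := mul_pos hδ hLpos
  set C : ℝ := (1 + κ) * (h₀ : ℝ) ^ L with hC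
  refine ⟨a, C, hapos, fun r hr => ?_⟩
  have hmon : Monotone (gammaR r) := monotone_nat_of_le_succ fun k => hmono r k
  have hr0 : (0 : ℝ) < r := by exact_mod_cast hr
  have hh0 : (0 : ℝ) < h₀ := by exact_mod_cast hh₀
  have hra : (r : ℝ) ^ a = ((r : ℝ) ^ δ) ^ L := by rw [ha, Real.rpow_mul hr0.le]
  have key : gammaR r 0 ≤ C * (r : ℝ) ^ (-a) := by
    by_cases hwin : (h₀ : ℝ) ≤ (r : ℝ) ^ δ
    · -- the window [h₀, r^δ] contains J = ⌊log₂(r^δ/h₀)⌋ doublings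
      set x : ℝ := Real.logb 2 ((r : ℝ) ^ δ / h₀) with hx
      have hx0 : 0 ≤ x := Real.logb_nonneg (by norm_num) (by rwa [le_div_iff₀ hh0, one_mul])
      set J : ℕ := ⌊x⌋₊ with hJ
      have hJle : (J : ℝ) ≤ x := Nat.floor_le hx0
      have hJgt : x < J + 1 := Nat.lt_floor_add_one x
      have h2x : (2 : ℝ) ^ x = (r : ℝ) ^ δ / h₀ :=
        Real.rpow_logb (by norm_num) (by norm_num) (by positivity)
      have hpow : ((h₀ * 2 ^ J : ℕ) : ℝ) ≤ (r : ℝ) ^ δ := by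
        push_cast
        have h2J : (2 : ℝ) ^ (J : ℝ) ≤ 2 ^ x := Real.rpow_le_rpow_of_exponent_le (by norm_num) hJle
        rw [Real.rpow_natCast] at h2J
        calc (h₀ : ℝ) * 2 ^ J ≤ h₀ * 2 ^ x := mul_le_mul_of_nonneg_left h2J hh0.le
          _ = h₀ * ((r : ℝ) ^ δ / h₀) := by rw [h2x]
          _ = (r : ℝ) ^ δ := by field_simp
      have hchain := iter_gain hκ hG r J hpow
      have hle1 : gammaR r (h₀ * 2 ^ J) ≤ 1 := gammaR_le_one _ _
      have hpowpos : (0 : ℝ) < (1 + κ) ^ J := by positivity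
      have hγh₀ : gammaR r h₀ ≤ 1 / (1 + κ) ^ J := by
        rw [le_div_iff₀ hpowpos, mul_comm]
        exact hchain.trans hle1
      have h1 : (1 + κ) ^ (x - 1) ≤ (1 + κ) ^ J := by
        have := Real.rpow_le_rpow_of_exponent_le hκ1.le (by linarith : x - 1 ≤ (J : ℝ))
        rwa [Real.rpow_natCast] at this
      have h2 : (1 + κ) ^ (x - 1) = (1 + κ) ^ x / (1 + κ) :=
        Real.rpow_sub_one (by positivity) x
      have h3 : (1 + κ) ^ x = (r : ℝ) ^ a / (h₀ : ℝ) ^ L := by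
        rw [Real.rpow_def_of_pos (by linarith), Real.rpow_def_of_pos hr0, Real.rpow_def_of_pos hh0,
          ← Real.exp_sub]
        congr 1
        have hlog2 : Real.log 2 ≠ 0 := by positivity
        rw [hx, ha, hL, Real.logb, Real.logb, Real.log_div (by positivity) (by positivity),
          Real.log_rpow hr0]
        field_simp
      have hxpos : (0 : ℝ) < (1 + κ) ^ (x - 1) := by positivity
      have hrapos : (0 : ℝ) < (r : ℝ) ^ a := by positivity
      have hh0L : (0 : ℝ) < (h₀ : ℝ) ^ L := by positivity
      calc gammaR r 0 ≤ gammaR r h₀ := hmon (Nat.zero_le _)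
        _ ≤ 1 / (1 + κ) ^ J := hγh₀
        _ ≤ 1 / (1 + κ) ^ (x - 1) := by gcongr
        _ = (1 + κ) * (h₀ : ℝ) ^ L / (r : ℝ) ^ a := by
            rw [h2, h3]; field_simp
        _ = C * (r : ℝ) ^ (-a) := by
            rw [hC, Real.rpow_neg hr0.le, div_eq_mul_inv]
    · -- empty window: the bound is ≥ 1
      have hlt : (r : ℝ) ^ δ < h₀ := lt_of_not_ge hwin
      have hlt' : ((r : ℝ) ^ δ) ^ L < (h₀ : ℝ) ^ L := Real.rpow_lt_rpow (by positivity) hlt hLpos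
      have hrapos : (0 : ℝ) < (r : ℝ) ^ a := by positivity
      have hone : (1 : ℝ) ≤ C * (r : ℝ) ^ (-a) := by
        rw [hC, Real.rpow_neg hr0.le, hra]
        rw [hra] at hrapos
        have : (1 : ℝ) ≤ (h₀ : ℝ) ^ L * (((r : ℝ) ^ δ) ^ L)⁻¹ := by
          rw [← div_eq_mul_inv, one_le_div hrapos]; exact hlt'.le
        nlinarith [this, hκ, inv_pos.2 hrapos, hlt'.le]
      exact (gammaR_le_one r 0).trans hone
  rw [gammaR_zero_eq_armH] at key
  exact key

/-! ## The composition, by name -/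

/-- **`QuantitativeBGN_of`**: the registered stubs imply the crux (four of five landed and discharged inside)
`Summit.CriticalPhenomena.PercolationContinuityZ3.Theses.PercLowPointHalfSpace.QuantitativeBGN`
(kernel-checked; no `sorry` outside the stubs). -/
theorem QuantitativeBGN_of (h4 : Registered.stub_pivotalFloorDensity) :
    Summit.CriticalPhenomena.PercolationContinuityZ3.Theses.PercLowPointHalfSpace.QuantitativeBGN :=
  -- STUBS 1, 2, 3a, 3b are LANDED theorems (p124045, p124349, p124635, p124410): discharged here, no longer hypotheses.
  Theorems.QuantitativeBGN.Negative.quantitativeBGN_iff.2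
    (quantitativeBGN_of_floorGain depthMono_holds
      (floorGain_of_russo noFloor_holds (floorRusso_of floorDeriv_holds russoCalc_holds) h4))

/-- Wiring check: the one open registered stub feeds `QuantitativeBGN_of` as stated. -/
example : Summit.CriticalPhenomena.PercolationContinuityZ3.Theses.PercLowPointHalfSpace.QuantitativeBGN :=
  QuantitativeBGN_of stub_pivotalFloorDensity

/-- **The reduction, unconditionally in the landed stubs**: the uniform pivotal-floor density bound ALONE
implies the crux (everything else is kernel-checked and landed). -/
theorem quantitativeBGN_of_pivotalFloorDensity (h4 : PivotalFloorDensity) :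
    Summit.CriticalPhenomena.PercolationContinuityZ3.Theses.PercLowPointHalfSpace.QuantitativeBGN :=
  QuantitativeBGN_of h4

/-- **The reduction through (G)**: the uniform microscopic floor-doubling gain ALONE implies the crux
(depth monotonicity is landed). -/
theorem quantitativeBGN_of_floorGain' (hG : FloorGain) :
    Summit.CriticalPhenomena.PercolationContinuityZ3.Theses.PercLowPointHalfSpace.QuantitativeBGN :=
  Theorems.QuantitativeBGN.Negative.quantitativeBGN_iff.2 (quantitativeBGN_of_floorGain depthMono_holds hG)

end Summit.CriticalPhenomena.PercolationContinuityZ3.Cruxes.QuantitativeBGN.MicroscopicFloorDoublingGain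

end
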